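import Summits.HodgeConjecture.CorCM.Census.TypeStabiliserSubgroup

/-!
# The square-root law: `𝒦` of `G × ℤ/4` is `(𝒦(G,c) ⊔ ⟨√c⟩) × ℤ/4`

COR-CM (cell `pub-hodgecm2`), count-neutral kernel combinatorics by the census seat lit-andre-3 (gen 22; lane
TYPE-STABILISER-SQUAREROOTS), sequel of `Census/TypeStabiliserSubgroup.lean` (`stabGen c = 𝒦(G,c) = ⟨c, {g | c ∉ ⟨g⟩}⟩`, the
subgroup generated by the type stabilisers; `G/𝒦` carries the excess term `d₂ = d(G/𝒦)` of the closed form of the coinvariant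
fibre, `Census/TypeStabiliserCharK.lean`).  Pure group theory, valid in every group; theorems only (no definition, no `decide`,
no certificate, no named fact, no `sorry`).  HONEST FRAMING: `HC_CM` is NOT proved, here or anywhere in the tree; nothing here is a
period or a headline.

THE LAW.  Let `c ∈ G` with `c² = 1 ≠ c`, and let `C = Multiplicative (ZMod 4)` (cyclic of order four).  In `G × C` the element
`(c,1)` is again an involution (central if `c` is), and

  **`𝒦(G × C, (c,1)) = (𝒦(G,c) ⊔ ⟨{q | q² = c}⟩) × C`**            (`stabGen_prod_eq`),

so that `(G × C)/𝒦 ≅ G/(𝒦 ⊔ ⟨√c⟩)`: **passing from `G` to `G × ℤ/4` kills, in `G/𝒦`, exactly the images of the square roots of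
`c`** (`index_stabGen_prod_eq` records the equality of indices).  Mechanism: `(q, g)` with `q² = c` and `g` a generator of `C`
is NOT a root of `(c,1)` — a power `(q,g)^k = (c,1)` needs `4 ∣ k`, but `q⁴ = 1` (`notMem_zpowers_sqrt_gen`) — while `p ∈ G`
with `c ∉ ⟨p⁴⟩` already lies in `𝒦 ⊔ ⟨√c⟩` (`mem_sup_sqrt_of_notMem_zpowers_pow_four`: if `c = pᵏ` then `k` odd puts `p` in
`𝒦`, `k ≡ 2 (4)` writes `p` through the square root `p^{k/2}` and the element `p⁴` of `𝒦`, and `4 ∣ k` is excluded).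

WHY IT IS RECORDED (lane memo `HOME/pub-hodgecm2-lit-andre-3/PORTFOLIO-lit-andre-3-g22.md`, §5 and §7bis).  The law is the
`λ = 0` case of the construction that REFUTES the structural guess «`Ω₁(G/𝒦)` is cyclic or dihedral» of the gen-21 memo: applied
to the `F`-pair of order `2¹³` with `G/𝒦 ≅ Q₈ × Q₈` (gen 21) it yields a pair of order `2¹⁵` with quotient `(Q₈ × Q₈)/(Z × Z) ≅
(ℤ/2)⁴`; its twisted form (`g p g⁻¹ = p·z^{λ(p)}`, paper) applied to `P₁₂₈` yields the least counterexample, of order `512`, with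
quotient `(ℤ/2)³` (kernel certificate not attempted: `PcGroupCode(5851737928037157047015829186854717846283120360223, 512)`,
`c = pcgs[8]`, verified numerically in three ways).  Nothing about those particular groups is asserted in this file.

## References
* [Pohlmann1968] H. Pohlmann, Algebraic cycles on abelian varieties of complex multiplication type, Ann. of Math. 88 (1968), Thm 1.
* [Milne1999] J. S. Milne, Lefschetz motives and the Tate conjecture, Compositio Math. 117 (1999), Prop. 2.1, p. 54.
-/

namespace Summit.HodgeConjecture.CorCM.Census.TypeStabiliser

section SquareRoots

variable {G : Type*} [Group G] (c : G)

/-! ## §1 Odd exponents: an element killed by an odd power misses `c` -/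

/-- If `aᵏ = 1` for an odd integer `k` then `c ∉ ⟨a⟩` (for `c² = 1 ≠ c`): from `c = aⁱ` we would get `cᵏ = (aᵏ)ⁱ = 1`, but
`cᵏ = c`. [folklore] -/
theorem notMem_zpowers_of_zpow_odd (hc2 : c * c = 1) (hc1 : c ≠ 1) {a : G} {k : ℤ} (hk : Odd k) (ha : a ^ k = 1) :
    c ∉ Subgroup.zpowers a := by
  intro h
  obtain ⟨i, hi⟩ := Subgroup.mem_zpowers_iff.mp h
  obtain ⟨j, rfl⟩ := hk
  have hcsq : c ^ (2 : ℤ) = 1 := by rw [zpow_two]; exact hc2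
  have h1 : c ^ (2 * j + 1) = 1 := by
    rw [← hi, ← zpow_mul, mul_comm i, zpow_mul, ha, one_zpow]
  have h2 : c ^ (2 * j + 1) = c := by
    rw [zpow_add, zpow_mul, hcsq, one_zpow, one_mul, zpow_one]
  exact hc1 (h2.symm.trans h1)

/-- An element killed by an odd power lies in `𝒦`. [folklore] -/
theorem mem_stabGen_of_zpow_odd (hc2 : c * c = 1) (hc1 : c ≠ 1) {a : G} {k : ℤ} (hk : Odd k) (ha : a ^ k = 1) :
    a ∈ stabGen c :=
  mem_stabGen_of_notMem_zpowers c (notMem_zpowers_of_zpow_odd c hc2 hc1 hk ha)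

/-! ## §2 The subgroup `𝒦 ⊔ ⟨√c⟩` and the fourth-power criterion -/

/-- A square root of `c` lies in `𝒦 ⊔ ⟨{q | q² = c}⟩`. [folklore] -/
theorem mem_sup_sqrt_of_mul_self {q : G} (hq : q * q = c) :
    q ∈ stabGen c ⊔ Subgroup.closure {q : G | q * q = c} :=
  Subgroup.mem_sup_right (Subgroup.subset_closure hq)

/-- `𝒦 ≤ 𝒦 ⊔ ⟨√c⟩`, elementwise. [folklore] -/
theorem mem_sup_sqrt_of_mem_stabGen {p : G} (hp : p ∈ stabGen c) :
    p ∈ stabGen c ⊔ Subgroup.closure {q : G | q * q = c} :=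
  Subgroup.mem_sup_left hp

/-- **The fourth-power criterion**: if `c ∉ ⟨p⁴⟩` then `p ∈ 𝒦 ⊔ ⟨√c⟩` (for `c² = 1 ≠ c`).  Indeed either `c ∉ ⟨p⟩` (then
`p ∈ 𝒦`), or `c = pᵏ`: for `k = 2j+1` the element `p²` is killed by the odd power `k`, so `p = c·(p²)^{-j} ∈ 𝒦`; for `k = 4m+2`
the element `q = p^{2m+1}` is a square root of `c` and `p⁴` is killed by the odd power `2m+1`, and `p = q^{2m+1}·(p⁴)^{-(m²+m)}`;
`k = 4m` contradicts the hypothesis. [folklore] -/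
theorem mem_sup_sqrt_of_notMem_zpowers_pow_four (hc2 : c * c = 1) (hc1 : c ≠ 1) {p : G}
    (hp : c ∉ Subgroup.zpowers (p ^ (4 : ℤ))) :
    p ∈ stabGen c ⊔ Subgroup.closure {q : G | q * q = c} := by
  by_cases h : c ∈ Subgroup.zpowers p
  swap
  · exact mem_sup_sqrt_of_mem_stabGen c (mem_stabGen_of_notMem_zpowers c h)
  obtain ⟨k, hk⟩ := Subgroup.mem_zpowers_iff.mp h
  -- write k = 4 m + r with 0 ≤ r < 4
  have h4 : k = 4 * (k / 4) + k % 4 := by omega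
  have hr0 : 0 ≤ k % 4 := by omega
  have hr4 : k % 4 < 4 := by omega
  set m := k / 4 with hm
  set r := k % 4 with hr
  -- the odd case, uniformly in j with k = 2 j + 1
  have hodd : ∀ j : ℤ, k = 2 * j + 1 → p ∈ stabGen c ⊔ Subgroup.closure {q : G | q * q = c} := by
    intro j hj
    apply mem_sup_sqrt_of_mem_stabGen
    have hsq : (p ^ (2 : ℤ)) ^ k = 1 := by
      rw [← zpow_mul, mul_comm, zpow_mul, hk, zpow_two, hc2]
    have h2 : p ^ (2 : ℤ) ∈ stabGen c := mem_stabGen_of_zpow_odd c hc2 hc1 ⟨j, hj⟩ hsq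
    have hp1 : p = c * (p ^ (2 : ℤ)) ^ (-j) := by
      rw [← hk, ← zpow_mul, ← zpow_add, hj]
      have : 2 * j + 1 + 2 * -j = 1 := by ring
      rw [this, zpow_one]
    rw [hp1]
    exact Subgroup.mul_mem _ (self_mem_stabGen c) (Subgroup.zpow_mem _ h2 _)
  interval_cases hrr : r
  · -- k = 4 m : contradiction
    exfalso
    apply hp
    refine Subgroup.mem_zpowers_iff.mpr ⟨m, ?_⟩
    rw [← zpow_mul, ← hk, h4]
    congr 1
    omega
  · exact hodd (2 * m) (by omega)
  · -- k = 4 m + 2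
    have hkm : k = 2 * (2 * m + 1) := by omega
    have hq : p ^ (2 * m + 1) * p ^ (2 * m + 1) = c := by
      rw [← zpow_add, ← hk, hkm]; congr 1; ring
    have hq' : p ^ (2 * m + 1) ∈ stabGen c ⊔ Subgroup.closure {q : G | q * q = c} :=
      mem_sup_sqrt_of_mul_self c hq
    have hb : (p ^ (4 : ℤ)) ^ (2 * m + 1) = 1 := by
      rw [← zpow_mul]
      have : (4 : ℤ) * (2 * m + 1) = k + k := by omega
      rw [this, zpow_add, hk, hc2]
    have hb' : p ^ (4 : ℤ) ∈ stabGen c ⊔ Subgroup.closure {q : G | q * q = c} :=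
      mem_sup_sqrt_of_mem_stabGen c (mem_stabGen_of_zpow_odd c hc2 hc1 ⟨m, rfl⟩ hb)
    have hp1 : p = (p ^ (2 * m + 1)) ^ (2 * m + 1) * (p ^ (4 : ℤ)) ^ (-(m ^ 2 + m)) := by
      rw [← zpow_mul, ← zpow_mul, ← zpow_add]
      have : (2 * m + 1) * (2 * m + 1) + 4 * -(m ^ 2 + m) = 1 := by ring
      rw [this, zpow_one]
    rw [hp1]
    exact Subgroup.mul_mem _ (Subgroup.zpow_mem _ hq' _) (Subgroup.zpow_mem _ hb' _)
  · exact hodd (2 * m + 1) (by omega)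

/-! ## §3 The cyclic group of order four -/

/-- Every element of `Multiplicative (ZMod 4)` is killed by `4`. [folklore] -/
theorem zmodFour_zpow_four (t : Multiplicative (ZMod 4)) : t ^ (4 : ℤ) = 1 := by
  have h : (4 : ℤ) • (Multiplicative.toAdd t) = 0 := by
    rw [zsmul_eq_mul]
    have : ((4 : ℤ) : ZMod 4) = 0 := (ZMod.intCast_zmod_eq_zero_iff_dvd 4 4).mpr (dvd_refl _)
    rw [this, zero_mul]
  have := congrArg Multiplicative.ofAdd h
  rwa [ofAdd_zsmul, ofAdd_toAdd, ofAdd_zero] at this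

/-- A power of the generator `g = ofAdd 1` of `Multiplicative (ZMod 4)` is trivial only for exponents divisible by `4`.
[folklore] -/
theorem four_dvd_of_gen_zpow_eq_one {k : ℤ} (hk : (Multiplicative.ofAdd (1 : ZMod 4)) ^ k = 1) : (4 : ℤ) ∣ k := by
  rw [← ofAdd_zsmul, zsmul_eq_mul, mul_one] at hk
  have hk' : ((k : ZMod 4)) = 0 := by
    have := congrArg Multiplicative.toAdd hk
    rwa [toAdd_ofAdd, toAdd_one] at this
  exact (ZMod.intCast_zmod_eq_zero_iff_dvd k 4).mp hk'

/-! ## §4 The square-root law -/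

/-- `(1, t)` is never a root of `(c, 1)` (`c ≠ 1`): its powers have first coordinate `1`. [folklore] -/
theorem notMem_zpowers_one_prod (hc1 : c ≠ 1) (t : Multiplicative (ZMod 4)) :
    ((c, (1 : Multiplicative (ZMod 4))) : G × Multiplicative (ZMod 4)) ∉
      Subgroup.zpowers (((1 : G), t) : G × Multiplicative (ZMod 4)) := by
  intro h
  obtain ⟨k, hk⟩ := Subgroup.mem_zpowers_iff.mp h
  have h1 := congrArg Prod.fst hk
  simp only [Prod.pow_fst, one_zpow] at h1
  exact hc1 h1.symm

/-- `(p, t)` is a root of `(c,1)` only if `p` is a root of `c`. [folklore] -/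
theorem mem_zpowers_of_mem_zpowers_prod {p : G} {t : Multiplicative (ZMod 4)}
    (h : ((c, (1 : Multiplicative (ZMod 4))) : G × Multiplicative (ZMod 4)) ∈ Subgroup.zpowers ((p, t) : G × _)) :
    c ∈ Subgroup.zpowers p := by
  obtain ⟨k, hk⟩ := Subgroup.mem_zpowers_iff.mp h
  have h1 := congrArg Prod.fst hk
  simp only [Prod.pow_fst] at h1
  exact Subgroup.mem_zpowers_iff.mpr ⟨k, h1⟩

/-- **A square root of `c` paired with a generator of `ℤ/4` is not a root of `(c,1)`**: `(q,g)^k = (c,1)` forces `4 ∣ k`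
(second coordinate) and then `qᵏ = (q⁴)^{k/4} = 1 ≠ c`. [folklore] -/
theorem notMem_zpowers_sqrt_gen (hc2 : c * c = 1) (hc1 : c ≠ 1) {q : G} (hq : q * q = c) :
    ((c, (1 : Multiplicative (ZMod 4))) : G × Multiplicative (ZMod 4)) ∉
      Subgroup.zpowers ((q, Multiplicative.ofAdd (1 : ZMod 4)) : G × Multiplicative (ZMod 4)) := by
  intro h
  obtain ⟨k, hk⟩ := Subgroup.mem_zpowers_iff.mp h
  have h1 := congrArg Prod.fst hk
  have h2 := congrArg Prod.snd hk
  simp only [Prod.pow_fst] at h1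
  simp only [Prod.pow_snd] at h2
  obtain ⟨m, rfl⟩ := four_dvd_of_gen_zpow_eq_one h2
  have hq4 : q ^ (4 : ℤ) = 1 := by
    have : (4 : ℤ) = 2 + 2 := by norm_num
    rw [this, zpow_add, zpow_two, hq, hc2]
  rw [zpow_mul, hq4, one_zpow] at h1
  exact hc1 h1.symm

/-- `(1, t) ∈ 𝒦(G × ℤ/4, (c,1))`. [folklore] -/
theorem one_prod_mem_stabGen (hc1 : c ≠ 1) (t : Multiplicative (ZMod 4)) :
    (((1 : G), t) : G × Multiplicative (ZMod 4)) ∈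
      stabGen ((c, (1 : Multiplicative (ZMod 4))) : G × Multiplicative (ZMod 4)) :=
  mem_stabGen_of_notMem_zpowers _ (notMem_zpowers_one_prod c hc1 t)

/-- `𝒦(G,c) × 1 ≤ 𝒦(G × ℤ/4, (c,1))`: a generator `p` of `𝒦(G,c)` with `c ∉ ⟨p⟩` gives `(c,1) ∉ ⟨(p,1)⟩`. [folklore] -/
theorem inl_mem_stabGen_of_mem {p : G} (hp : p ∈ stabGen c) :
    ((p, (1 : Multiplicative (ZMod 4))) : G × Multiplicative (ZMod 4)) ∈
      stabGen ((c, (1 : Multiplicative (ZMod 4))) : G × Multiplicative (ZMod 4)) := by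
  have hmap : (stabGen c).map (MonoidHom.inl G (Multiplicative (ZMod 4))) ≤
      stabGen ((c, (1 : Multiplicative (ZMod 4))) : G × Multiplicative (ZMod 4)) := by
    rw [stabGen, MonoidHom.map_closure, Subgroup.closure_le]
    rintro x ⟨g, hg, rfl⟩
    rcases hg with hg | hg
    · rw [Set.mem_singleton_iff] at hg
      rw [hg]
      exact self_mem_stabGen _
    · refine mem_stabGen_of_notMem_zpowers _ fun h => hg ?_
      exact mem_zpowers_of_mem_zpowers_prod c h
  exact hmap (Subgroup.mem_map_of_mem _ hp)

/-- `√c × 1 ≤ 𝒦(G × ℤ/4, (c,1))`: `(q,1) = (q,g)·(1,g)⁻¹` with both factors non-roots of `(c,1)`. [folklore] -/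
theorem sqrt_prod_one_mem_stabGen (hc2 : c * c = 1) (hc1 : c ≠ 1) {q : G} (hq : q * q = c) :
    ((q, (1 : Multiplicative (ZMod 4))) : G × Multiplicative (ZMod 4)) ∈
      stabGen ((c, (1 : Multiplicative (ZMod 4))) : G × Multiplicative (ZMod 4)) := by
  have h1 : ((q, Multiplicative.ofAdd (1 : ZMod 4)) : G × Multiplicative (ZMod 4)) ∈
      stabGen ((c, (1 : Multiplicative (ZMod 4))) : G × Multiplicative (ZMod 4)) :=
    mem_stabGen_of_notMem_zpowers _ (notMem_zpowers_sqrt_gen c hc2 hc1 hq)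
  have h2 := one_prod_mem_stabGen c hc1 (Multiplicative.ofAdd (1 : ZMod 4))
  have h3 := Subgroup.mul_mem _ h1 (Subgroup.inv_mem _ h2)
  have heq : ((q, Multiplicative.ofAdd (1 : ZMod 4)) : G × Multiplicative (ZMod 4)) *
      (((1 : G), Multiplicative.ofAdd (1 : ZMod 4)) : G × Multiplicative (ZMod 4))⁻¹ = (q, 1) := by
    rw [Prod.inv_mk, Prod.mk_mul_mk, inv_one, mul_one, mul_inv_cancel]
  rwa [heq] at h3

/-- **THE SQUARE-ROOT LAW.**  For `c² = 1 ≠ c`:  `𝒦(G × ℤ/4, (c,1)) = (𝒦(G,c) ⊔ ⟨{q | q² = c}⟩) × ℤ/4`.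
(≥): the three families of generators above.  (≤): a non-root `(p,t)` of `(c,1)` has `c ∉ ⟨p⁴⟩` (as `(p,t)^{4m} = (p^{4m}, 1)`),
so `p ∈ 𝒦 ⊔ ⟨√c⟩` by the fourth-power criterion. [folklore] -/
theorem stabGen_prod_eq (hc2 : c * c = 1) (hc1 : c ≠ 1) :
    stabGen ((c, (1 : Multiplicative (ZMod 4))) : G × Multiplicative (ZMod 4)) =
      (stabGen c ⊔ Subgroup.closure {q : G | q * q = c}).prod ⊤ := by
  apply le_antisymm
  · rw [stabGen_le_iff_subset]
    refine ⟨Subgroup.mem_prod.mpr ⟨mem_sup_sqrt_of_mem_stabGen c (self_mem_stabGen c), Subgroup.mem_top _⟩, ?_⟩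
    rintro ⟨p, t⟩ hpt
    refine Subgroup.mem_prod.mpr ⟨mem_sup_sqrt_of_notMem_zpowers_pow_four c hc2 hc1 fun h => hpt ?_, Subgroup.mem_top _⟩
    obtain ⟨m, hm⟩ := Subgroup.mem_zpowers_iff.mp h
    refine Subgroup.mem_zpowers_iff.mpr ⟨4 * m, ?_⟩
    rw [Prod.pow_mk, zpow_mul, zpow_mul, hm, zmodFour_zpow_four, one_zpow]
  · rintro ⟨p, t⟩ hpt
    obtain ⟨hp, -⟩ := Subgroup.mem_prod.mp hpt
    have heq : ((p, t) : G × Multiplicative (ZMod 4)) = (p, 1) * (1, t) := by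
      rw [Prod.mk_mul_mk, mul_one, one_mul]
    rw [heq]
    refine Subgroup.mul_mem _ ?_ (one_prod_mem_stabGen c hc1 t)
    -- `p ∈ 𝒦 ⊔ ⟨√c⟩`; push the generators across
    have hmap : (stabGen c ⊔ Subgroup.closure {q : G | q * q = c}).map
        (MonoidHom.inl G (Multiplicative (ZMod 4))) ≤
        stabGen ((c, (1 : Multiplicative (ZMod 4))) : G × Multiplicative (ZMod 4)) := by
      rw [Subgroup.map_sup, sup_le_iff, MonoidHom.map_closure, Subgroup.closure_le]
      refine ⟨?_, ?_⟩
      · rintro x ⟨g, hg, rfl⟩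
        exact inl_mem_stabGen_of_mem c hg
      · rintro x ⟨q, hq, rfl⟩
        exact sqrt_prod_one_mem_stabGen c hc2 hc1 hq
    exact hmap (Subgroup.mem_map_of_mem _ hp)

/-- **Index form of the law**: `[G × ℤ/4 : 𝒦(G × ℤ/4, (c,1))] = [G : 𝒦(G,c) ⊔ ⟨√c⟩]` — adjoining a central cyclic factor of
order four divides `|G/𝒦|` exactly by the order of the image of the square roots of `c`. [folklore] -/
theorem index_stabGen_prod_eq (hc2 : c * c = 1) (hc1 : c ≠ 1) :
    (stabGen ((c, (1 : Multiplicative (ZMod 4))) : G × Multiplicative (ZMod 4))).index =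
      (stabGen c ⊔ Subgroup.closure {q : G | q * q = c}).index := by
  rw [stabGen_prod_eq c hc2 hc1, Subgroup.index_prod, Subgroup.index_top, mul_one]

/-- In particular **`𝒦(G × ℤ/4, (c,1)) = 𝒦(G,c) × ℤ/4` when every square root of `c` already lies in `𝒦(G,c)`** (e.g. when
`c` has no square root at all), so then `G/𝒦` is unchanged. [folklore] -/
theorem stabGen_prod_eq_of_sqrt_mem (hc2 : c * c = 1) (hc1 : c ≠ 1) (h : ∀ q : G, q * q = c → q ∈ stabGen c) :
    stabGen ((c, (1 : Multiplicative (ZMod 4))) : G × Multiplicative (ZMod 4)) = (stabGen c).prod ⊤ := by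
  rw [stabGen_prod_eq c hc2 hc1]
  congr 1
  refine le_antisymm (sup_le le_rfl ((Subgroup.closure_le _).mpr fun q hq => h q hq)) le_sup_left

end SquareRoots

end Summit.HodgeConjecture.CorCM.Census.TypeStabiliser
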